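import Summits.NavierStokesRegularity.NavierStokesRegularity.Theorems.TypeICertificateLadderRungReynoldsOneH1Rate
import Literature.Analysis.FluidPDE.ConstantinDirectionDissipationProofs
import Literature.Analysis.FluidPDE.EnstrophyGronwall
import Literature.Analysis.FluidPDE.SpaceTimeCalculus

/-! # Enstrophy control before the blow-up time — crux stmt-NavierStokesRegularity-11291 (`CoreLogGas.BlowupIsLocallyDriven`), line registered, stub stub_enstrophyControl

Registered stub `stub_enstrophyControl` (`--supports stmt-NavierStokesRegularity-11291`) of the
line `registered` of the crux `CoreLogGas.BlowupIsLocallyDriven`: a classical solution `(u, p)`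
of the unforced Navier–Stokes system on `ℝ³ × [0, T)` which is Leray–Hopf from its rapidly
decaying datum `u 0` has

* finite enstrophy `∫ ‖∇u(t)‖² < ∞` at EVERY time `t ∈ [0, T)`, and
* `t ↦ ‖∇u(t)‖_{L²}` integrable on `[0, T)`.

Proof. (a) For `t ∈ [0, T)` the closed sub-slab `[0, (t + T)/2]` carries bounds on all `L²`
Sobolev norms (Tao 2013, Cor. 11.1: `RungReynoldsOne.hasBoundedSobolevNormsOn_subslab`); the case
`n = 1` is `∫⁻ ‖∇u(t)‖ₑ² < ∞`, and `∇u(t)` is continuous. (b) The Leray–Hopf energy inequality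
read through the classical gradient (`IsLerayHopfOn.lintegral_frobeniusNormSq_fderiv_of_classical`)
gives `∫₀ᵀ ∫ |∇u|²_F < ∞`; since the operator norm is dominated by the Frobenius norm,
`e(t) = ∫ ‖∇u(t)‖²` is integrable on `(0, T)` (measurability from the joint continuity of
`(t, y) ↦ ∇u(t, y)` on `[0, T) × ℝ³`), and `√e ≤ 1 + e` on the bounded interval.
-/

noncomputable section

open Set MeasureTheory Filter Topology Function
open scoped ENNReal NNReal ContDiff

namespace Summit.NavierStokesRegularity.NavierStokesRegularity.Theorems.BlowupIsLocallyDriven.Registered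

open Literature.Analysis.FluidPDE

-- The summit namespace `Summit.NavierStokesRegularity.NavierStokesRegularity.…` is fixed by the
-- route (problem and summit share the name), so the duplicated component is intended.
set_option linter.dupNamespace false

/-- **Finite enstrophy at every time before `T`.** For a classical solution on `ℝ³ × [0, T)`,
Leray–Hopf from its rapidly decaying datum, `y ↦ ‖∇u(t, y)‖²` is integrable for every
`t ∈ [0, T)` (Tao 2013, Cor. 11.1 on the closed sub-slab `[0, (t+T)/2]`:
`RungReynoldsOne.hasBoundedSobolevNormsOn_subslab`, case `n = 1`). [cite: Tao2011, Cor. 11.1 + Cor. 4.3 + Thm. 5.4 (iv)] -/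
theorem enstrophyControl_integrable_sq_norm_fderiv {ν T : ℝ} (hν : 0 < ν)
    {u : ℝ → EuclideanSpace ℝ (Fin 3) → EuclideanSpace ℝ (Fin 3)}
    {p : ℝ → EuclideanSpace ℝ (Fin 3) → ℝ}
    (hsol : IsClassicalNSSolutionOn (Ico 0 T) ν 0 u p) (hLH : IsLerayHopfOn T ν 0 (u 0) u)
    (h₀ : HasRapidSpatialDecay (u 0)) {t : ℝ} (ht : t ∈ Ico 0 T) :
    Integrable (fun y => ‖fderiv ℝ (u t) y‖ ^ 2) (volume : Measure (EuclideanSpace ℝ (Fin 3))) := by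
  set T₁ : ℝ := (t + T) / 2 with hT₁
  have hT₁0 : 0 < T₁ := by rw [hT₁]; linarith [ht.1, ht.2]
  have hT₁T : T₁ < T := by rw [hT₁]; linarith [ht.2]
  have htT₁ : t ≤ T₁ := by rw [hT₁]; linarith [ht.2]
  obtain ⟨C₁, hC₁⟩ :=
    RungReynoldsOne.hasBoundedSobolevNormsOn_subslab hν hsol hLH h₀ hT₁0 hT₁T 1
  have hfin : ∫⁻ y, ‖fderiv ℝ (u t) y‖ₑ ^ 2 ≤ C₁ := by
    have h := hC₁ t ⟨ht.1, htT₁⟩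
    simpa only [enorm_iteratedFDeriv_one] using h
  have hDc : Continuous (fderiv ℝ (u t)) :=
    (hsol.contDiff_velocity ht).continuous_fderiv (by simp)
  exact integrable_sq_norm_of_lintegral_lt_top hDc (hfin.trans_lt ENNReal.coe_lt_top)

/-- **The enstrophy is integrable in time on `[0, T)`.** For a classical solution on
`ℝ³ × [0, T)`, Leray–Hopf from its rapidly decaying datum, `t ↦ ∫ ‖∇u(t)‖²` is integrable on
`[0, T)`: `∫₀ᵀ∫ |∇u|²_F < ∞` by the energy inequality through the classical gradient
(Constantin 1990, (2.21): `IsLerayHopfOn.lintegral_frobeniusNormSq_fderiv_of_classical`),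
`‖∇u‖² ≤ |∇u|²_F`, and measurability from the joint continuity of `∇u` on `[0, T) × ℝ³`.
[cite: Constantin1990, §2 eq. (2.21)] -/
theorem enstrophyControl_integrableOn_enstrophy {ν T : ℝ} (hν : 0 < ν) (hT : 0 < T)
    {u : ℝ → EuclideanSpace ℝ (Fin 3) → EuclideanSpace ℝ (Fin 3)}
    {p : ℝ → EuclideanSpace ℝ (Fin 3) → ℝ}
    (hsol : IsClassicalNSSolutionOn (Ico 0 T) ν 0 u p) (hLH : IsLerayHopfOn T ν 0 (u 0) u)
    (h₀ : HasRapidSpatialDecay (u 0)) :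
    IntegrableOn (fun t => ∫ y, ‖fderiv ℝ (u t) y‖ ^ 2) (Ico 0 T) := by
  -- space–time dissipation bound through the classical gradient
  obtain ⟨hD, -⟩ := IsLerayHopfOn.lintegral_frobeniusNormSq_fderiv_of_classical hsol hLH hT
  -- measurability of the enstrophy in time
  have hGc : ContinuousOn (fun z : ℝ × EuclideanSpace ℝ (Fin 3) => fderiv ℝ (u z.1) z.2)
      (Ico 0 T ×ˢ univ) :=
    hsol.smooth_velocity.continuousOn_fderiv_slice (uniqueDiffOn_Ico 0 T)
  have hGm : AEStronglyMeasurable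
      (fun z : ℝ × EuclideanSpace ℝ (Fin 3) => ‖fderiv ℝ (u z.1) z.2‖ ^ 2)
      (((volume : Measure ℝ).restrict (Ico 0 T)).prod
        (volume : Measure (EuclideanSpace ℝ (Fin 3)))) := by
    rw [Measure.restrict_prod_eq_prod_univ]
    exact (hGc.norm.pow 2).aestronglyMeasurable (measurableSet_Ico.prod MeasurableSet.univ)
  have hem : AEStronglyMeasurable (fun t => ∫ y, ‖fderiv ℝ (u t) y‖ ^ 2)
      ((volume : Measure ℝ).restrict (Ico 0 T)) :=
    hGm.integral_prod_right'
  refine ⟨hem, ?_⟩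
  rw [hasFiniteIntegral_iff_enorm]
  calc ∫⁻ t in Ico 0 T, ‖∫ y, ‖fderiv ℝ (u t) y‖ ^ 2‖ₑ
      = ∫⁻ t in Ioo 0 T, ‖∫ y, ‖fderiv ℝ (u t) y‖ ^ 2‖ₑ := setLIntegral_congr Ioo_ae_eq_Ico.symm
    _ ≤ ∫⁻ τ in Ioo 0 T, ∫⁻ x, ENNReal.ofReal (frobeniusNormSq (fderiv ℝ (u τ) x)) := by
        refine setLIntegral_mono' measurableSet_Ioo fun t ht => ?_
        rw [Real.enorm_eq_ofReal (integral_nonneg fun _ => sq_nonneg _),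
          ofReal_integral_sq_norm
            (enstrophyControl_integrable_sq_norm_fderiv hν hsol hLH h₀ (Ioo_subset_Ico_self ht))]
        exact lintegral_mono fun _ => enorm_sq_fderiv_le_ofReal_frobeniusNormSq _
    _ < ⊤ := hD.lt_top

/-- **stub E — `stub_enstrophyControl` (Navier–Stokes regularity theory before the blow-up
time).** A classical solution on `[0,T)` which is Leray–Hopf from a rapidly decaying datum has
finite enstrophy `∫‖∇u(t)‖² < ∞` at EVERY `t ∈ [0,T)` (Tao 2013, Cor. 11.1: all `L²` Sobolev norms
are bounded on every closed sub-slab `[0, T'']`, `T'' < T`), and `t ↦ ‖∇u(t)‖₂` is integrable on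
`[0,T)` (energy inequality through the classical gradient, `√e ≤ 1 + e` on the bounded time
interval). [cite: Tao2011, Cor. 11.1 + Cor. 4.3 + Thm. 5.4 (iv); Constantin1990, §2 eq. (2.21)] -/
theorem stub_enstrophyControl :
    ∀ (ν T : ℝ), 0 < ν → 0 < T →
    ∀ (u : ℝ → EuclideanSpace ℝ (Fin 3) → EuclideanSpace ℝ (Fin 3)) (p : ℝ → EuclideanSpace ℝ (Fin 3) → ℝ),
      Literature.Analysis.FluidPDE.IsClassicalNSSolutionOn (Set.Ico 0 T) ν 0 u p →
      Literature.Analysis.FluidPDE.IsLerayHopfOn T ν 0 (u 0) u →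
      Literature.Analysis.FluidPDE.HasRapidSpatialDecay (u 0) →
      (∀ t ∈ Set.Ico 0 T, MeasureTheory.Integrable (fun y => ‖fderiv ℝ (u t) y‖ ^ 2) MeasureTheory.volume) ∧
      MeasureTheory.IntegrableOn (fun t => Real.sqrt (∫ y, ‖fderiv ℝ (u t) y‖ ^ 2)) (Set.Ico 0 T) MeasureTheory.volume := by
  intro ν T hν hT u p hsol hLH h₀
  refine ⟨fun t ht => enstrophyControl_integrable_sq_norm_fderiv hν hsol hLH h₀ ht, ?_⟩
  have he : IntegrableOn (fun t => ∫ y, ‖fderiv ℝ (u t) y‖ ^ 2) (Ico 0 T) :=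
    enstrophyControl_integrableOn_enstrophy hν hT hsol hLH h₀
  have h1e : IntegrableOn (fun t => 1 + ∫ y, ‖fderiv ℝ (u t) y‖ ^ 2) (Ico 0 T) :=
    (integrableOn_const (by rw [Real.volume_Ico]; exact ENNReal.ofReal_ne_top)).add he
  refine h1e.mono' (Real.continuous_sqrt.comp_aestronglyMeasurable he.aestronglyMeasurable)
    (Eventually.of_forall fun t => ?_)
  have h0 : 0 ≤ ∫ y, ‖fderiv ℝ (u t) y‖ ^ 2 := integral_nonneg fun _ => sq_nonneg _
  rw [Real.norm_eq_abs, abs_of_nonneg (Real.sqrt_nonneg _), Real.sqrt_le_left (by positivity)]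
  nlinarith

end Summit.NavierStokesRegularity.NavierStokesRegularity.Theorems.BlowupIsLocallyDriven.Registered
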